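import Summits.Ventures.PercRepro.C025ProfileThinHallStepsB

/-!
# THE PARALLEL-PAIR STEPS OF THE ROW AND OF ITS HALL FORM AT EVERY LEVEL (night-3 g17)
`profileIneq_of_parallel` / `hallIneq_of_parallel` (`C025ProfileThinRowStepsB` / `C025ProfileThinHallStepsC`) are the steps at the level
`u = q + 2` of the row `(q+1, u)`.  The same proofs work at EVERY level `u ≥ q + 2`, because the rooted-price comparison holds at every
level: the ratio of the rooted price `C(p+q+2, u)/C(p+q+2, q+1)` to the contraction's price `C(p+q, u−1)/C(p+q, q)` is
`(q+1)(p+1)/(u(p+q+2−u))`, at most `1` exactly when `u − 1 ≤ p` — the common threshold (`choose_ratio_shift_le`: for `k ≤ j` and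
`j + k ≤ n`, `C(n+2, j+1)/C(n+2, k+1) ≤ C(n, j)/C(n, k)`, the difference of the two products being `(j−k)(n−j−k) ≥ 0`).
* `choose_shift_mul`, `choose_ratio_shift_le`, `price_rooted_le_level` — the arithmetic at every level;
* **`profileIneq_of_parallel_level`** (`q u`, `q + 1 ≤ u`): `ProfileIneq (M ＼ {y}) (q+1) (u+1)` and `ProfileIneq ((M ／ {x}) ＼ {y}) q u`
  give `ProfileIneq M (q+1) (u+1)` — the proof of the level-`(q+2)` step verbatim with `u + 1` for the level (the Hall form:
  `C025ProfileThinHallLevel`).  With the loop steps (already at every level) these are the single-element reductions of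
  the rows `(q, u)` for every `u`: the rows `(q, u)` on every matroid reduce to the simple matroids, and the row `(q, q+2)` on thin(q)
  matroids (the next crux instance `(q+3, q)`) needs only its simple thin case.
No `def`, no `instance`, no notation.  Axioms: standard.
-/
open scoped Matroid
namespace PercRepro
open Set Finset ThmH Staged
namespace ThinGirth
variable {α : Type} [DecidableEq α] {M : Matroid α} [M.Finite]

omit [DecidableEq α] [M.Finite] in
/-- `C(n+2, j+1) · (j+1)(n+1−j) = (n+2)(n+1) · C(n, j)` for `j ≤ n`. -/
theorem choose_shift_mul (n j : ℕ) :
    (Nat.choose (n + 2) (j + 1) : ℚ) * ((j + 1 : ℚ) * ((n + 1 - j : ℕ) : ℚ)) =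
      ((n + 2 : ℚ) * (n + 1)) * (Nat.choose n j : ℚ) := by
  have h1 : (n + 1 + 1) * Nat.choose (n + 1) j = Nat.choose (n + 1 + 1) (j + 1) * (j + 1) :=
    Nat.add_one_mul_choose_eq (n + 1) j
  have h2 : Nat.choose n j * (n + 1) = Nat.choose (n + 1) j * (n + 1 - j) := Nat.choose_mul_succ_eq n j
  have h1' : ((n : ℚ) + 1 + 1) * (Nat.choose (n + 1) j : ℚ) = (Nat.choose (n + 2) (j + 1) : ℚ) * ((j : ℚ) + 1) := by
    exact_mod_cast h1
  have h2' : (Nat.choose n j : ℚ) * ((n : ℚ) + 1) = (Nat.choose (n + 1) j : ℚ) * ((n + 1 - j : ℕ) : ℚ) := by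
    exact_mod_cast h2
  calc (Nat.choose (n + 2) (j + 1) : ℚ) * ((j + 1 : ℚ) * ((n + 1 - j : ℕ) : ℚ))
      = ((Nat.choose (n + 2) (j + 1) : ℚ) * ((j : ℚ) + 1)) * ((n + 1 - j : ℕ) : ℚ) := by ring
    _ = (((n : ℚ) + 1 + 1) * (Nat.choose (n + 1) j : ℚ)) * ((n + 1 - j : ℕ) : ℚ) := by rw [h1']
    _ = ((n : ℚ) + 1 + 1) * ((Nat.choose (n + 1) j : ℚ) * ((n + 1 - j : ℕ) : ℚ)) := by ring
    _ = ((n : ℚ) + 1 + 1) * ((Nat.choose n j : ℚ) * ((n : ℚ) + 1)) := by rw [h2']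
    _ = ((n + 2 : ℚ) * (n + 1)) * (Nat.choose n j : ℚ) := by ring

omit [DecidableEq α] [M.Finite] in
/-- **The rooted-price comparison at every level**: for `k ≤ j` and `j + k ≤ n`,
`C(n+2, j+1)/C(n+2, k+1) ≤ C(n, j)/C(n, k)` (the ratio of the two sides is `(k+1)(n+1−k)/((j+1)(n+1−j)) ≤ 1`). -/
theorem choose_ratio_shift_le (n j k : ℕ) (hkj : k ≤ j) (hjn : j + k ≤ n) :
    (Nat.choose (n + 2) (j + 1) : ℚ) / (Nat.choose (n + 2) (k + 1) : ℚ) ≤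
      (Nat.choose n j : ℚ) / (Nat.choose n k : ℚ) := by
  have hjn' : j ≤ n := by omega
  have hkn' : k ≤ n := by omega
  have hA := choose_shift_mul n j
  have hB := choose_shift_mul n k
  have cj : (0 : ℚ) < Nat.choose (n + 2) (j + 1) := by exact_mod_cast Nat.choose_pos (by omega)
  have ck : (0 : ℚ) < Nat.choose (n + 2) (k + 1) := by exact_mod_cast Nat.choose_pos (by omega)
  have cj' : (0 : ℚ) < Nat.choose n j := by exact_mod_cast Nat.choose_pos hjn'
  have ck' : (0 : ℚ) < Nat.choose n k := by exact_mod_cast Nat.choose_pos hkn'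
  have hDj : (0 : ℚ) < (j + 1 : ℚ) * ((n + 1 - j : ℕ) : ℚ) := by
    have : (0 : ℚ) < ((n + 1 - j : ℕ) : ℚ) := by exact_mod_cast (by omega : 0 < n + 1 - j)
    positivity
  have hDk : (0 : ℚ) < (k + 1 : ℚ) * ((n + 1 - k : ℕ) : ℚ) := by
    have : (0 : ℚ) < ((n + 1 - k : ℕ) : ℚ) := by exact_mod_cast (by omega : 0 < n + 1 - k)
    positivity
  -- the core: `(k+1)(n+1−k) ≤ (j+1)(n+1−j)`
  have key : (k + 1 : ℚ) * ((n + 1 - k : ℕ) : ℚ) ≤ (j + 1 : ℚ) * ((n + 1 - j : ℕ) : ℚ) := by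
    rw [Nat.cast_sub (by omega : j ≤ n + 1), Nat.cast_sub (by omega : k ≤ n + 1)]
    push_cast
    have hkj' : (k : ℚ) ≤ j := by exact_mod_cast hkj
    have hjn'' : (j : ℚ) + k ≤ n := by exact_mod_cast hjn
    nlinarith [mul_nonneg (sub_nonneg.2 hkj') (sub_nonneg.2 (show (j : ℚ) + k ≤ n from hjn''))]
  rw [div_le_div_iff₀ ck ck']
  apply le_of_mul_le_mul_right _ (mul_pos hDj hDk)
  have hc : (0 : ℚ) ≤ ((n + 2 : ℚ) * (n + 1)) * (Nat.choose n j : ℚ) * (Nat.choose n k : ℚ) := by positivity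
  calc (Nat.choose (n + 2) (j + 1) : ℚ) * (Nat.choose n k : ℚ) *
        (((j + 1 : ℚ) * ((n + 1 - j : ℕ) : ℚ)) * ((k + 1 : ℚ) * ((n + 1 - k : ℕ) : ℚ)))
      = ((Nat.choose (n + 2) (j + 1) : ℚ) * ((j + 1 : ℚ) * ((n + 1 - j : ℕ) : ℚ))) *
          ((Nat.choose n k : ℚ) * ((k + 1 : ℚ) * ((n + 1 - k : ℕ) : ℚ))) := by ring
    _ = (((n + 2 : ℚ) * (n + 1)) * (Nat.choose n j : ℚ)) *
          ((Nat.choose n k : ℚ) * ((k + 1 : ℚ) * ((n + 1 - k : ℕ) : ℚ))) := by rw [hA]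
    _ = (((n + 2 : ℚ) * (n + 1)) * (Nat.choose n j : ℚ) * (Nat.choose n k : ℚ)) *
          ((k + 1 : ℚ) * ((n + 1 - k : ℕ) : ℚ)) := by ring
    _ ≤ (((n + 2 : ℚ) * (n + 1)) * (Nat.choose n j : ℚ) * (Nat.choose n k : ℚ)) *
          ((j + 1 : ℚ) * ((n + 1 - j : ℕ) : ℚ)) := mul_le_mul_of_nonneg_left key hc
    _ = (Nat.choose n j : ℚ) * ((((n + 2 : ℚ) * (n + 1)) * (Nat.choose n k : ℚ)) *
          ((j + 1 : ℚ) * ((n + 1 - j : ℕ) : ℚ))) := by ring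
    _ = (Nat.choose n j : ℚ) * (((Nat.choose (n + 2) (k + 1) : ℚ) * ((k + 1 : ℚ) * ((n + 1 - k : ℕ) : ℚ))) *
          ((j + 1 : ℚ) * ((n + 1 - j : ℕ) : ℚ))) := by rw [hB]
    _ = (Nat.choose n j : ℚ) * (Nat.choose (n + 2) (k + 1) : ℚ) *
          (((j + 1 : ℚ) * ((n + 1 - j : ℕ) : ℚ)) * ((k + 1 : ℚ) * ((n + 1 - k : ℕ) : ℚ))) := by ring


/-- The rooted price (complement rank `p + 1` in `M`) at `(q+1, u+1)` is at most the price at `(q, u)` of a set with complement rank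
`p` in `N`, for every level `u ≥ q + 1`. -/
theorem price_rooted_le_level {N : Matroid α} [N.Finite] (q u : ℕ) (hqu : q + 1 ≤ u) {B B' : Finset α}
    (h : M.eRk ((gr M \ B : Finset α) : Set α) = N.eRk ((gr N \ B' : Finset α) : Set α) + 1) :
    Profile.price M (q + 1) (u + 1) B ≤ Profile.price N q u B' := by
  unfold Profile.price
  rw [h, ← coe_rkN, ← Nat.cast_succ, ENat.toNat_coe, ENat.toNat_coe]
  by_cases hup : u ≤ rkN N (gr N \ B')
  · rw [if_pos (by exact_mod_cast (by omega : u + 1 ≤ rkN N (gr N \ B') + 1)), if_pos (by exact_mod_cast hup)]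
    have e1 : rkN N (gr N \ B') + 1 + (q + 1) = rkN N (gr N \ B') + q + 2 := by omega
    rw [e1]
    exact choose_ratio_shift_le (rkN N (gr N \ B') + q) u q (by omega) (by omega)
  · rw [if_neg (by
      intro hc
      apply hup
      have : u + 1 ≤ rkN N (gr N \ B') + 1 := by exact_mod_cast hc
      omega)]
    rw [if_neg (by intro hc; apply hup; exact_mod_cast hc)]

/-- **A parallel pair is a profile Theorem F**: for non-loops `x ≠ y` with `y ∈ cl{x}`, the row `(q+1, q+2)` of `M` follows from the
row `(q+1, q+2)` of `M ＼ {y}` and the row `(q, q+1)` of `(M ／ {x}) ＼ {y}`. -/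
theorem profileIneq_of_parallel_level {x y : α} (hx : M.Indep {x}) (hy : M.Indep {y}) (hxy : x ≠ y)
    (hpar : y ∈ M.closure {x}) (q u : ℕ) (hqu : q + 1 ≤ u)
    (h1 : Profile.ProfileIneq (M ＼ {y}) (q + 1) (u + 1))
    (h2 : Profile.ProfileIneq ((M ／ {x}) ＼ {y}) q u) :
    Profile.ProfileIneq M (q + 1) (u + 1) := by
  have hxE : x ∈ M.E := hx.subset_ground (mem_singleton x)
  have hyE : y ∈ M.E := hy.subset_ground (mem_singleton y)
  -- `x ∈ cl{y}` from `y ∈ cl{x}` and `y` a non-loop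
  have hpar' : x ∈ M.closure {y} := by
    by_contra hnx
    have hdep : ¬ M.Indep (insert y {x}) := by
      rw [hx.insert_indep_iff_of_notMem (by simpa using hxy.symm)]
      exact fun h => h.2 hpar
    apply hdep
    rw [Set.pair_comm, hy.insert_indep_iff_of_notMem (by simpa using hxy)]
    exact ⟨hxE, hnx⟩
  have hxg : x ∈ gr M := mem_gr_of_mem_ground hxE
  have hyg : y ∈ gr M := mem_gr_of_mem_ground hyE
  -- the three ground sets
  have hG'' : gr ((M ／ {x}) ＼ {y}) = ((gr M).erase x).erase y := by rw [gr_delete, gr_contract]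
  set G'' := ((gr M).erase x).erase y with hG''def
  have hxG'' : x ∉ G'' := by
    rw [hG''def, Finset.erase_right_comm]
    exact Finset.notMem_erase x _
  have hyG'' : y ∉ G'' := Finset.notMem_erase y _
  have hG' : gr (M ＼ {y}) = insert x G'' := by
    rw [gr_delete, hG''def, Finset.erase_right_comm, Finset.insert_erase (Finset.mem_erase.2 ⟨hxy, hxg⟩)]
  have hG : gr M = insert y (insert x G'') := by
    rw [hG''def, Finset.erase_right_comm, Finset.insert_erase (Finset.mem_erase.2 ⟨hxy, hxg⟩),
      Finset.insert_erase hyg]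
  -- facts about `T ⊆ G''`
  have hTE : ∀ T ⊆ G'', (T : Set α) ⊆ M.E := by
    intro T hT
    have : T ⊆ gr M := hT.trans ((Finset.erase_subset _ _).trans (Finset.erase_subset _ _))
    rw [← coe_gr]
    exact_mod_cast this
  have hxT : ∀ T ⊆ G'', x ∉ T := fun T hT h => hxG'' (hT h)
  have hyT : ∀ T ⊆ G'', y ∉ T := fun T hT h => hyG'' (hT h)
  have hxTE : ∀ T ⊆ G'', ((insert x T : Finset α) : Set α) ⊆ M.E := by
    intro T hT
    rw [Finset.coe_insert]
    exact insert_subset hxE (hTE T hT)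
  have hyTE : ∀ T ⊆ G'', ((insert y T : Finset α) : Set α) ⊆ M.E := by
    intro T hT
    rw [Finset.coe_insert]
    exact insert_subset hyE (hTE T hT)
  -- ranks
  have ra : ∀ T ⊆ G'', M.eRk (T : Set α) = (M ＼ {y}).eRk (T : Set α) := fun T hT =>
    (delete_singleton_eRk_eq (coe_subset_diff_singleton (hTE T hT) (hyT T hT))).symm
  have rb : ∀ T ⊆ G'', M.eRk ((insert x T : Finset α) : Set α) = (M ＼ {y}).eRk ((insert x T : Finset α) : Set α) := by
    intro T hT
    refine (delete_singleton_eRk_eq (coe_subset_diff_singleton (hxTE T hT) ?_)).symm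
    rw [Finset.mem_insert]
    rintro (h | h)
    · exact hxy h.symm
    · exact hyT T hT h
  have rd : ∀ T ⊆ G'', M.eRk ((insert y (insert x T) : Finset α) : Set α) = M.eRk ((insert x T : Finset α) : Set α) := by
    intro T hT
    rw [Finset.coe_insert y, eRk_insert_eq_of_mem_closure (hxTE T hT)]
    refine M.closure_subset_closure ?_ hpar
    rw [Finset.coe_insert]
    exact singleton_subset_iff.2 (mem_insert x _)
  have rc : ∀ T ⊆ G'', M.eRk ((insert y T : Finset α) : Set α) = M.eRk ((insert x T : Finset α) : Set α) := by
    intro T hT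
    have h1 : M.eRk ((insert x (insert y T) : Finset α) : Set α) = M.eRk ((insert y T : Finset α) : Set α) := by
      rw [Finset.coe_insert x, eRk_insert_eq_of_mem_closure (hyTE T hT)]
      refine M.closure_subset_closure ?_ hpar'
      rw [Finset.coe_insert]
      exact singleton_subset_iff.2 (mem_insert y _)
    rw [← h1, Finset.insert_comm, rd T hT]
  have re : ∀ T ⊆ G'', (M ＼ {y}).eRk ((insert x T : Finset α) : Set α) = ((M ／ {x}) ＼ {y}).eRk (T : Set α) + 1 := by
    intro T hT
    have hTx : (T : Set α) ⊆ M.E \ {x} := coe_subset_diff_singleton (hTE T hT) (hxT T hT)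
    have hTxy : (T : Set α) ⊆ (M ／ {x}).E \ {y} := by
      rw [Matroid.contract_ground]
      exact fun z hz => ⟨hTx hz, fun h => hyT T hT (mem_singleton_iff.1 h ▸ Finset.mem_coe.1 hz)⟩
    rw [delete_singleton_eRk_eq hTxy, contract_singleton_eRk_add_one hx hTx, ← Finset.coe_insert, rb T hT]
  -- complements
  have c0 : ∀ T ⊆ G'', gr M \ T = insert y (insert x (G'' \ T)) := by
    intro T hT
    rw [hG, Finset.insert_sdiff_of_notMem _ (hyT T hT), Finset.insert_sdiff_of_notMem _ (hxT T hT)]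
  have hyxT : ∀ T ⊆ G'', y ∉ insert x T := by
    intro T hT h
    rw [Finset.mem_insert] at h
    rcases h with h | h
    · exact hxy h.symm
    · exact hyT T hT h
  have hxyT : ∀ T ⊆ G'', x ∉ insert y T := by
    intro T hT h
    rw [Finset.mem_insert] at h
    rcases h with h | h
    · exact hxy h
    · exact hxT T hT h
  have hxGT : ∀ T ⊆ G'', x ∉ G'' \ T := fun T _ h => hxG'' (Finset.mem_sdiff.1 h).1
  have hyGT : ∀ T ⊆ G'', y ∉ G'' \ T := fun T _ h => hyG'' (Finset.mem_sdiff.1 h).1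
  have cx : ∀ T ⊆ G'', gr M \ insert x T = insert y (G'' \ T) := by
    intro T hT
    rw [hG, Finset.insert_sdiff_of_notMem _ (hyxT T hT), Finset.insert_sdiff_insert, Finset.sdiff_insert,
      Finset.erase_eq_of_notMem (hxGT T hT)]
  have cy : ∀ T ⊆ G'', gr M \ insert y T = insert x (G'' \ T) := by
    intro T hT
    rw [hG, Finset.insert_sdiff_insert, Finset.insert_sdiff_of_notMem _ (hxyT T hT), Finset.sdiff_insert,
      Finset.erase_eq_of_notMem (hyGT T hT)]
  have cxy : ∀ T ⊆ G'', gr M \ insert y (insert x T) = G'' \ T := by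
    intro T hT
    rw [hG, Finset.insert_sdiff_insert, Finset.insert_comm y x T, Finset.insert_sdiff_insert, Finset.sdiff_insert,
      Finset.sdiff_insert, Finset.erase_eq_of_notMem (hyGT T hT), Finset.erase_eq_of_notMem (hxGT T hT)]
  have c0' : ∀ T ⊆ G'', gr (M ＼ {y}) \ T = insert x (G'' \ T) := by
    intro T hT
    rw [hG', Finset.insert_sdiff_of_notMem _ (hxT T hT)]
  have cx' : ∀ T ⊆ G'', gr (M ＼ {y}) \ insert x T = G'' \ T := by
    intro T hT
    rw [hG', Finset.insert_sdiff_insert, Finset.sdiff_insert, Finset.erase_eq_of_notMem (hxGT T hT)]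
  have cN : ∀ T ⊆ G'', gr ((M ／ {x}) ＼ {y}) \ T = G'' \ T := by
    intro T _
    rw [hG'']
  have hGT : ∀ T ⊆ G'', G'' \ T ⊆ G'' := fun T _ => Finset.sdiff_subset
  -- the row, unfolded on both sides
  unfold Profile.ProfileIneq at h1 h2 ⊢
  rw [sum_Rq_eq_sum_powerset, card_levelSet_eq_sum] at h1 h2 ⊢
  rw [hG, sum_powerset_insert_insert hxy hxG'' hyG'', sum_powerset_insert_insert hxy hxG'' hyG'']
  rw [hG', Finset.sum_powerset_insert hxG'', Finset.sum_powerset_insert hxG''] at h1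
  rw [hG''] at h2
  -- the left side of `M`: the left side of `M ＼ {y}` plus twice the rooted terms
  have hL : ∀ T ∈ G''.powerset,
      ((if M.eRk (T : Set α) = ((q + 1 : ℕ) : ℕ∞) then Profile.price M (q + 1) (u + 1) T else 0) +
        (if M.eRk ((insert x T : Finset α) : Set α) = ((q + 1 : ℕ) : ℕ∞) then
          Profile.price M (q + 1) (u + 1) (insert x T) else 0) +
        (if M.eRk ((insert y T : Finset α) : Set α) = ((q + 1 : ℕ) : ℕ∞) then
          Profile.price M (q + 1) (u + 1) (insert y T) else 0) +
        (if M.eRk ((insert y (insert x T) : Finset α) : Set α) = ((q + 1 : ℕ) : ℕ∞) then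
          Profile.price M (q + 1) (u + 1) (insert y (insert x T)) else 0)) =
      ((if (M ＼ {y}).eRk (T : Set α) = ((q + 1 : ℕ) : ℕ∞) then Profile.price (M ＼ {y}) (q + 1) (u + 1) T else 0) +
        (if (M ＼ {y}).eRk ((insert x T : Finset α) : Set α) = ((q + 1 : ℕ) : ℕ∞) then
          Profile.price (M ＼ {y}) (q + 1) (u + 1) (insert x T) else 0)) +
      2 * (if ((M ／ {x}) ＼ {y}).eRk (T : Set α) = (q : ℕ∞) then
          Profile.price M (q + 1) (u + 1) (insert x T) else 0) := by
    intro T hT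
    rw [Finset.mem_powerset] at hT
    have t1 : (if M.eRk (T : Set α) = ((q + 1 : ℕ) : ℕ∞) then Profile.price M (q + 1) (u + 1) T else 0) =
        (if (M ＼ {y}).eRk (T : Set α) = ((q + 1 : ℕ) : ℕ∞) then Profile.price (M ＼ {y}) (q + 1) (u + 1) T else 0) := by
      refine ite_congr_of_iff (by rw [ra T hT]) (fun _ => ?_)
      apply price_eq_of_eRk_eq
      rw [c0 T hT, c0' T hT, rd _ (hGT T hT), rb _ (hGT T hT)]
    have t4 : (if M.eRk ((insert y (insert x T) : Finset α) : Set α) = ((q + 1 : ℕ) : ℕ∞) then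
          Profile.price M (q + 1) (u + 1) (insert y (insert x T)) else 0) =
        (if (M ＼ {y}).eRk ((insert x T : Finset α) : Set α) = ((q + 1 : ℕ) : ℕ∞) then
          Profile.price (M ＼ {y}) (q + 1) (u + 1) (insert x T) else 0) := by
      refine ite_congr_of_iff (by rw [rd T hT, rb T hT]) (fun _ => ?_)
      apply price_eq_of_eRk_eq
      rw [cxy T hT, cx' T hT, ra _ (hGT T hT)]
    have t2 : (if M.eRk ((insert x T : Finset α) : Set α) = ((q + 1 : ℕ) : ℕ∞) then
          Profile.price M (q + 1) (u + 1) (insert x T) else 0) =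
        (if ((M ／ {x}) ＼ {y}).eRk (T : Set α) = (q : ℕ∞) then Profile.price M (q + 1) (u + 1) (insert x T) else 0) := by
      refine ite_congr_of_iff ?_ (fun _ => rfl)
      rw [rb T hT, re T hT, eRk_add_one_eq_iff]
    have t3 : (if M.eRk ((insert y T : Finset α) : Set α) = ((q + 1 : ℕ) : ℕ∞) then
          Profile.price M (q + 1) (u + 1) (insert y T) else 0) =
        (if ((M ／ {x}) ＼ {y}).eRk (T : Set α) = (q : ℕ∞) then Profile.price M (q + 1) (u + 1) (insert x T) else 0) := by
      refine ite_congr_of_iff ?_ (fun _ => ?_)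
      · rw [rc T hT, rb T hT, re T hT, eRk_add_one_eq_iff]
      · apply price_eq_of_eRk_eq
        rw [cy T hT, cx T hT, rc _ (hGT T hT)]
    rw [t1, t2, t3, t4]
    ring
  -- the right side of `M`: the right side of `M ＼ {y}` plus twice the rank-`(q+1)` sets of `N`
  have hR : ∀ T ∈ G''.powerset,
      ((if M.eRk (T : Set α) = ((u + 1 : ℕ) : ℕ∞) then (1 : ℚ) else 0) +
        (if M.eRk ((insert x T : Finset α) : Set α) = ((u + 1 : ℕ) : ℕ∞) then (1 : ℚ) else 0) +
        (if M.eRk ((insert y T : Finset α) : Set α) = ((u + 1 : ℕ) : ℕ∞) then (1 : ℚ) else 0) +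
        (if M.eRk ((insert y (insert x T) : Finset α) : Set α) = ((u + 1 : ℕ) : ℕ∞) then (1 : ℚ) else 0)) =
      ((if (M ＼ {y}).eRk (T : Set α) = ((u + 1 : ℕ) : ℕ∞) then (1 : ℚ) else 0) +
        (if (M ＼ {y}).eRk ((insert x T : Finset α) : Set α) = ((u + 1 : ℕ) : ℕ∞) then (1 : ℚ) else 0)) +
      2 * (if ((M ／ {x}) ＼ {y}).eRk (T : Set α) = (u : ℕ∞) then (1 : ℚ) else 0) := by
    intro T hT
    rw [Finset.mem_powerset] at hT
    have t1 : (if M.eRk (T : Set α) = ((u + 1 : ℕ) : ℕ∞) then (1 : ℚ) else 0) =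
        (if (M ＼ {y}).eRk (T : Set α) = ((u + 1 : ℕ) : ℕ∞) then (1 : ℚ) else 0) := by
      rw [ra T hT]
    have t4 : (if M.eRk ((insert y (insert x T) : Finset α) : Set α) = ((u + 1 : ℕ) : ℕ∞) then (1 : ℚ) else 0) =
        (if (M ＼ {y}).eRk ((insert x T : Finset α) : Set α) = ((u + 1 : ℕ) : ℕ∞) then (1 : ℚ) else 0) := by
      rw [rd T hT, rb T hT]
    have t2 : (if M.eRk ((insert x T : Finset α) : Set α) = ((u + 1 : ℕ) : ℕ∞) then (1 : ℚ) else 0) =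
        (if ((M ／ {x}) ＼ {y}).eRk (T : Set α) = (u : ℕ∞) then (1 : ℚ) else 0) := by
      refine ite_congr_of_iff ?_ (fun _ => rfl)
      rw [rb T hT, re T hT, eRk_add_one_eq_iff]
    have t3 : (if M.eRk ((insert y T : Finset α) : Set α) = ((u + 1 : ℕ) : ℕ∞) then (1 : ℚ) else 0) =
        (if ((M ／ {x}) ＼ {y}).eRk (T : Set α) = (u : ℕ∞) then (1 : ℚ) else 0) := by
      refine ite_congr_of_iff ?_ (fun _ => rfl)
      rw [rc T hT, rb T hT, re T hT, eRk_add_one_eq_iff]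
    rw [t1, t2, t3, t4]
    ring
  -- the rooted terms are at most the terms of the row `(q, q+1)` of `N`
  have hrooted : ∀ T ∈ G''.powerset,
      (if ((M ／ {x}) ＼ {y}).eRk (T : Set α) = (q : ℕ∞) then Profile.price M (q + 1) (u + 1) (insert x T) else 0) ≤
        (if ((M ／ {x}) ＼ {y}).eRk (T : Set α) = (q : ℕ∞) then Profile.price ((M ／ {x}) ＼ {y}) q u T else 0) := by
    intro T hT
    rw [Finset.mem_powerset] at hT
    refine ite_le_of_iff Iff.rfl (fun _ => ?_)
    apply price_rooted_le_level q u hqu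
    rw [cx T hT, cN T hT, rc _ (hGT T hT), rb _ (hGT T hT), re _ (hGT T hT)]
  rw [Finset.sum_congr rfl hL, Finset.sum_congr rfl hR, Finset.sum_add_distrib, Finset.sum_add_distrib,
    Finset.sum_add_distrib, Finset.sum_add_distrib, ← Finset.mul_sum, ← Finset.mul_sum]
  have := Finset.sum_le_sum hrooted
  linarith

end ThinGirth
end PercRepro
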